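import Literature.AlgebraicGeometry.AbelianSchemes.AbelianSchemeBaseChangeComp
import Literature.AlgebraicGeometry.AbelianSchemes.AbelianSchemeOverRigidity
import Literature.AlgebraicGeometry.Motives.TrivialLocusFieldDescent
import Literature.AlgebraicGeometry.Motives.SemicontinuityGrothendieckComplexProofs
import Literature.AlgebraicGeometry.Motives.AbelianVarietyQuotientAction
import Literature.AlgebraicGeometry.AbelianVarieties.HomogeneousLineBundleDivisor
import Literature.AlgebraicGeometry.Modules.CechClassClassPullback
import Literature.AlgebraicGeometry.Morphisms.SubschemeIntegral
import Mathlib.FieldTheory.IsAlgClosed.AlgebraicClosure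
import HarnessLib

/-!
# The `Pic⁰` locus of a family of line bundles on an abelian variety is CLOSED (Mumford §8, §10; Milne I §8)

Layer `Literature/AlgebraicGeometry/AbelianVarieties`, namespace `Literature.AlgebraicGeometry.AbelianVarieties`.
THEOREMS ONLY (no definition, no named fact, no instance, no `sorry`).

Setting: an abelian variety `A₀` over a field `k`, a `k`-scheme `T` and a rank-one module `M` on `A₀ × T` (e.g. the
module `ℒ.L` of a rigidified line bundle `ℒ` on `A₀ × T`, ★ `AbelianSchemeOver.RigidifiedLineBundle` for the
abelian scheme `ofAbelianVariety A₀` over `Spec k`).  For a geometric point `t : Spec Ω → T` the fibre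
`(A₀ × T)_t` is an abelian variety over `Ω` (★ `AbelianSchemeOver.fibre` / `toAbelianVariety`) carrying the fibre
module `M_t` (★ `RigidifiedLineBundle.fibreModule`), and «`M_t ∈ Pic⁰`» is ★ `IsHomogeneous` ([Mukai1978] Def. 4.4:
`t_P^*M_t ≅ M_t` for every `P ∈ (A₀ × T)_t(Ω)`; [MumfordAV1970] §8 (i)).  The **`Pic⁰` locus** is the set of
scheme points `x ∈ T` such that `M_t ∈ Pic⁰` for EVERY geometric point `t` over `x` ([MumfordAV1970] §10,
[MilneAV2008] I §8 condition (a)); it is written out as a set in the statements.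

ROAD («open projection»):
* §1 the class `N(M) := m_T^*[M] · (p₁₃^*[M])⁻¹ ∈ Ȟ¹(A₀ × (A₀ × T), 𝒪^×)` of the family
  `{t_b^*M_s ⊗ M_s⁻¹}_{(b, s) ∈ A₀ × T}` (`m_T (a, (b, s)) = (ab, s)`, `p₁₃ (a, (b, s)) = (a, s)`) and its SLICE
  FORMULA `cechPic_pullback_whiskerLeft_lift_familyClass`: along the `L`-point `(a, t)` of `A₀ × T` the class of
  `N(M)` on `A₀ ⊗ Spec L = (A₀)_L` is `t_a^*[M_t] · [M_t]⁻¹` ([MumfordAV1970] §8 «`Λ(L)|_{X × {a}} ≅ T_a^*L ⊗ L⁻¹`»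
  in the family; ★ `AbelianVariety.transl_fst`);
* §2 `isHomogeneous_baseChange_iff_forall_transl` — homogeneity on `(A₀)_L` ⟺ `t_a^*[E] = [E]` for all `a ∈ A₀(L)`
  (★ `isHomogeneous_iff_forall_pullback_detClass_eq`, ★ `pointsMulEquiv`);
* §3 `isHomogeneous_fibre_iff_baseChange` — the fibre of `(ofAbelianVariety A₀)_T` at an `L`-point IS `(A₀)_L`
  (★ `AbelianSchemeOver.fibreBaseChangeIso`, ★ `isHomogeneous_pullback_iff_of_iso`);
* §4 `base_mem_trivialLocus_iff` — for an `L`-point `w` of the base, `w ∈ Z(D)` iff the class of `D` along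
  `P × w` is trivial (★ `CartierDivisor.preimage_trivialLocus_eq` + descent of triviality along the residue-field
  extension ★ `linEquiv_zero_of_classPullback_whiskerLeft_fieldExt`, [GortzWedhorn2023] Thm. 24.66 (1));
* §5 **`isClosed_setOf_forall_isHomogeneous_fibre`** — for `T` INTEGRAL and locally of finite type: the `Pic⁰`
  locus is the complement of `pr_T(A₀ × T ∖ Z)`, where `Z ⊆ A₀ × T` is the trivial locus of (a divisor of)
  `N(M)` viewed as a family over `A₀ × T` — CLOSED by the seesaw theorem ★ `seesaw_isClosed_trivialLocus_holds`
  ([GortzWedhorn2023] Thm. 24.66 (3), [MumfordAV1970] §5 Cor. 6 / §10) — and `pr_T : A₀ × T → T` is OPEN (flat of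
  finite presentation, ★ `UniversallyOpen`); hence the locus is closed.  The fibre criterion
  «`x ∈` locus ⟺ `pr_T⁻¹(x) ⊆ Z`» is §§1–4 at the geometric points over `x`, in both directions for every geometric
  point; `isClosed_picZeroLocus_of_isIntegral` — the same for the module of a rigidified line bundle;
* §6 `isHomogeneous_fibre_comp_iff` — the fibre condition along a `k`-morphism of bases `g : T'' → T`
  (`M ↦ (A₀ × g)^* M`); §7 `exists_fac_subschemeι_vanishingIdeal` — a geometric point of `T` over a point of a closed
  subset `Z` factors through the REDUCED closed subscheme `V(𝒥_Z)` (Mathlib `IsClosedImmersion.lift`; the kernel of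
  `Spec Ω → T` is the vanishing ideal sheaf of `{x}⁻`);
* §8 **`isClosed_setOf_forall_isHomogeneous_fibre_of_isAffine`** / **`isClosed_picZeroLocus`** — `T` AFFINE of finite
  type (reducible / non-reduced allowed): the locus is the finite union, over the irreducible components `Z` of `T`
  with reduced structure `ι_Z : T_Z ↪ T` (★ `Morphisms/SubschemeIntegral.isIntegral_subscheme`), of the images
  `ι_Z(locus of (A₀ × ι_Z)^*M)`, each closed by §5.

Cell `hodgecm-mathlib` (D-0151), road M13 node N0 (0d-2b): the closedness input of the limit descent of the `Pic⁰`
condition to a finite-type stage.  HC_CM is proved only modulo the 7 printed citations until rung 0 closes.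

## References
* [MumfordAV1970] D. Mumford, *Abelian Varieties* (1970), §5 Cor. 6 (seesaw), §8 pp. 74–80 (`Pic⁰`, (i) ⇔ (iv),
  `Λ(L)|_{X × {a}} ≅ T_a^*L ⊗ L⁻¹`), §10 p. 89 (the `Pic⁰` condition in families).
* [MilneAV2008] J. S. Milne, *Abelian Varieties* (v2.00, 2008), I §8 pp. 36–40 (condition (a) of the dual pair).
* [GortzWedhorn2023] U. Görtz, T. Wedhorn, *Algebraic Geometry II* (2023), Thm. 24.66 (1), (3) (pp. 405–408).
* [GortzWedhorn2020] U. Görtz, T. Wedhorn, *Algebraic Geometry I*, 2nd ed. (2020), Section (4.7), Prop. 3.27,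
  Thm. 14.35 (flat + locally of finite presentation ⇒ universally open).
* [Mukai1978] S. Mukai, *Semi-homogeneous vector bundles on an abelian variety* (1978), Def. 4.4 (p. 253).
* [Hartshorne1977] R. Hartshorne, *Algebraic Geometry* (1977), II Ex. 3.11 (d), II Ex. 6.8.
-/

noncomputable section

-- `Scheme.Modules` / the `Over` tensor structure are not reducible (as in ★ `AbelianSchemes/AbelianSchemeDualPair`).
set_option backward.isDefEq.respectTransparency false

open CategoryTheory CategoryTheory.Limits AlgebraicGeometry MonoidalCategory CartesianMonoidalCategory
open Literature.AlgebraicGeometry.Motives Literature.AlgebraicGeometry.Modules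
open Literature.AlgebraicGeometry.AbelianSchemes
open scoped MonObj

universe u

namespace Literature.AlgebraicGeometry.AbelianVarieties

/-! ### §0 Plumbing: `f^* g^* = (f ≫ g)^*` on `Ȟ¹(–, 𝒪^×)` -/

/-- `f^*(g^*x) = (f ≫ g)^*x` on `Ȟ¹(·, 𝒪^×)` (re-derived privately from `detClass_pullback`, as in ★
`AbelianVarieties/PoincareSheafFibrewisePicZero`, to keep the import cone small). [cite: Hartshorne1977, II Ex. 6.8 (a)] -/
private theorem cechPic_pullback_pullback {X Y Z : Scheme.{u}} (f : X ⟶ Y) (g : Y ⟶ Z) (x : CechPic Z) :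
    CechPic.pullback f (CechPic.pullback g x) = CechPic.pullback (f ≫ g) x := by
  obtain ⟨c, rfl⟩ := CechPic.mk_surjective x
  have hE := c.isFiniteLocallyFree_lineBundle
  rw [← c.detClass_lineBundle, ← detClass_pullback, ← detClass_pullback, ← detClass_pullback]
  exact (detClass_eq_of_iso ((Scheme.Modules.pullbackComp f g).app (lineBundle c)).symm _ _).symm

variable {k : Type u} [Field k] (A₀ : AbelianVariety k) (T : SchemeOver k)

/-! ### §1 The family class `N(M) = m_T^*[M] · (p₁₃^*[M])⁻¹` on `A₀ × (A₀ × T)` and its slice formula -/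

section Slice

variable (L : Type u) [Field L] [Algebra k L]

/-- **Slice formula for the family `{t_b^* M_t ⊗ M_t⁻¹}`** ([MumfordAV1970] §8 «`Λ(L)|_{X × {a}} ≅ T_a^*L ⊗ L⁻¹`»,
in the family over `T`): for a class `c ∈ Ȟ¹(A₀ × T, 𝒪^×)`, an `L`-point `a ∈ A₀(L)` and an `L`-point `t` of
`T`, the pull-back of `N(c) := m_T^*c · (p₁₃^*c)⁻¹` (`m_T (x, (b, s)) = (xb, s)`, `p₁₃ (x, (b, s)) = (x, s)`) along
the slice `A₀ × (a, t) : A₀ ⊗ Spec L → A₀ ⊗ (A₀ ⊗ T)` is `t_a^*(j_t^*c) · (j_t^*c)⁻¹` on `(A₀)_L = A₀ ⊗ Spec L`, where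
`j_t = A₀ × t : (A₀)_L → A₀ × T` is the fibre inclusion and `t_a` the translation of `(A₀)_L` by `a`
(★ `AbelianVariety.transl`, `transl_fst`: `t_a ≫ pr₁ = (a ∘ pr₂) · pr₁`). [cite: MumfordAV1970, §8 (pp. 78–80)]
[cite: GortzWedhorn2023, Def./Rem. 27.1 (p. 604)] -/
theorem cechPic_pullback_whiskerLeft_lift_familyClass (c : CechPic (A₀.X ⊗ T).left) (a : A₀.Points L)
    (t : AlgPoints T L) (j : A₀.bcLeft L ⟶ (A₀.X ⊗ T).left) (hj : j = (A₀.X ◁ t).left)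
    (G : A₀.bcLeft L ⟶ (A₀.X ⊗ (A₀.X ⊗ T)).left) (hG : G = (A₀.X ◁ lift a t).left) :
    CechPic.pullback G
        (CechPic.pullback (lift (fst A₀.X (A₀.X ⊗ T) * (snd A₀.X (A₀.X ⊗ T) ≫ fst A₀.X T))
            (snd A₀.X (A₀.X ⊗ T) ≫ snd A₀.X T)).left c *
          (CechPic.pullback (A₀.X ◁ snd A₀.X T).left c)⁻¹) =
      CechPic.pullback (A₀.transl L a) (CechPic.pullback j c) * (CechPic.pullback j c)⁻¹ := by
  subst hj hG
  -- `(A₀ × (a, t)) ≫ m_T = (pr₁ · (a ∘ pr₂), t ∘ pr₂)` as `k`-morphisms out of `A₀ ⊗ Spec L`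
  have e1 : A₀.X ◁ lift a t ≫ lift (fst A₀.X (A₀.X ⊗ T) * (snd A₀.X (A₀.X ⊗ T) ≫ fst A₀.X T))
      (snd A₀.X (A₀.X ⊗ T) ≫ snd A₀.X T) =
      lift (snd A₀.X (specOver k L) ≫ a * fst A₀.X (specOver k L)) (snd A₀.X (specOver k L) ≫ t) := by
    refine CartesianMonoidalCategory.hom_ext _ _ ?_ ?_
    · rw [Category.assoc, lift_fst, lift_fst, MonObj.comp_mul, whiskerLeft_fst, ← Category.assoc,
        whiskerLeft_snd, Category.assoc, lift_fst, mul_comm]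
    · rw [Category.assoc, lift_snd, lift_snd, ← Category.assoc, whiskerLeft_snd, Category.assoc, lift_snd]
  -- the projections of the fibre inclusion `j_t = A₀ × t`
  have hf : (A₀.X ◁ t).left ≫ pullback.fst A₀.X.hom T.hom = pullback.fst A₀.X.hom (AbelianVariety.bcSpec k L) :=
    Over.whiskerLeft_left_fst t
  have hs : (A₀.X ◁ t).left ≫ pullback.snd A₀.X.hom T.hom = pullback.snd A₀.X.hom (AbelianVariety.bcSpec k L) ≫ t.left :=
    Over.whiskerLeft_left_snd t
  -- `(A₀ × (a, t)) ≫ m_T = t_a ≫ j_t` on underlying schemes (★ `transl_fst`, `transl_snd`)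
  have h1 : ((A₀.X ◁ lift a t).left : A₀.bcLeft L ⟶ (A₀.X ⊗ (A₀.X ⊗ T)).left) ≫
      (lift (fst A₀.X (A₀.X ⊗ T) * (snd A₀.X (A₀.X ⊗ T) ≫ fst A₀.X T))
        (snd A₀.X (A₀.X ⊗ T) ≫ snd A₀.X T)).left = A₀.transl L a ≫ (A₀.X ◁ t).left := by
    rw [← Over.comp_left, e1]
    apply pullback.hom_ext
    · rw [Category.assoc, hf, AbelianVariety.transl_fst, Over.lift_left, pullback.lift_fst]
      rfl
    · rw [Category.assoc, hs, AbelianVariety.transl_snd_assoc, Over.lift_left, pullback.lift_snd, Over.comp_left,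
        Over.snd_left]
      rfl
  -- `(A₀ × (a, t)) ≫ p₁₃ = j_t`
  have h2 : ((A₀.X ◁ lift a t).left : A₀.bcLeft L ⟶ (A₀.X ⊗ (A₀.X ⊗ T)).left) ≫ (A₀.X ◁ snd A₀.X T).left =
      (A₀.X ◁ t).left := by
    rw [← Over.comp_left, ← MonoidalCategory.whiskerLeft_comp, lift_snd]
  rw [map_mul, map_inv, cechPic_pullback_pullback, cechPic_pullback_pullback, h1, h2,
    ← cechPic_pullback_pullback]

end Slice

/-! ### §2 Homogeneity on `(A₀)_L` through the translations by `A₀(L)` -/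

section Transl

variable (L : Type u) [Field L] [Algebra k L]

/-- **`E ∈ Pic⁰((A₀)_L)` iff `t_a^*[E] = [E]` for all `a ∈ A₀(L)`** — Mukai's homogeneity on the base change
`(A₀)_L` read through `A₀(L) ≃ (A₀)_L(L)` (★ `pointsMulEquiv`) and the class criterion for rank one
(★ `isHomogeneous_iff_forall_pullback_detClass_eq`). [cite: Mukai1978, Def. 4.4 (p. 253)] [cite: MumfordAV1970, §8 (definition of Pic⁰)] -/
theorem isHomogeneous_baseChange_iff_forall_transl {E : (A₀.baseChange L).X.left.Modules} (h₁ : HasRank E 1)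
    (hE : IsFiniteLocallyFree E) :
    IsHomogeneous (A₀.baseChange L) E ↔
      ∀ a : A₀.Points L, CechPic.pullback (A₀.transl L a) (detClass hE) = detClass hE := by
  rw [isHomogeneous_iff_forall_pullback_detClass_eq _ h₁ hE]
  refine ⟨fun h a => h (A₀.pointsMulEquiv L a), fun h P => ?_⟩
  obtain ⟨a, rfl⟩ := (A₀.pointsMulEquiv L).surjective P
  exact h a

end Transl

/-! ### §3 The geometric fibre of `(A₀ × T, M)` at an `L`-point of `T` is `((A₀)_L, j_t^* M)` -/

section Fibre

variable (L : Type u) [Field L] [Algebra k L]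

/-- **The fibre of `(ofAbelianVariety A₀)_T` at an `L`-point IS the base change `(A₀)_L`**: for an `L`-point `t` of `T` (a `k`-morphism
`Spec L → T`) and a module `M` on `A₀ × T`, the fibre abelian variety `((A₀ × T) ×_T Spec L)` of the abelian scheme
`(ofAbelianVariety A₀)_T` at `t` with the fibre module `M|` is homogeneous iff `j_t^* M` is homogeneous on `(A₀)_L`,
`j_t = A₀ × t` — transport along ★ `AbelianSchemeOver.fibreBaseChangeIso` (`(A_T)_t ≅ A_{t ≫ T → Spec k}` as
abelian varieties) with ★ `isHomogeneous_pullback_iff_of_iso`. [cite: GortzWedhorn2020, Section (4.7) (pp. 107–108)]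
[cite: Mukai1978, Def. 4.4 (p. 253)] -/
theorem isHomogeneous_fibre_iff_baseChange (t : AlgPoints T L) (M : (A₀.X ⊗ T).left.Modules) :
    IsHomogeneous (((AbelianSchemeOver.ofAbelianVariety A₀).baseChange T.hom).fibre t.left).toAbelianVariety
        ((Scheme.Modules.pullback
          (pullback.fst ((AbelianSchemeOver.ofAbelianVariety A₀).baseChange T.hom).X.hom t.left)).obj M) ↔
      IsHomogeneous (A₀.baseChange L) ((Scheme.Modules.pullback (A₀.X ◁ t).left).obj M) := by
  -- general form over a point `u : Spec L → T` and its structure map `s`, then `u = t`, `s = Spec L → Spec k`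
  have key : ∀ (s : Spec (.of L) ⟶ Spec (.of k)) (u : Spec (.of L) ⟶ T.left) (hs : u ≫ T.hom = s),
      IsHomogeneous (((AbelianSchemeOver.ofAbelianVariety A₀).baseChange T.hom).fibre u).toAbelianVariety
          ((Scheme.Modules.pullback
            (pullback.fst ((AbelianSchemeOver.ofAbelianVariety A₀).baseChange T.hom).X.hom u)).obj M) ↔
        IsHomogeneous ((AbelianSchemeOver.ofAbelianVariety A₀).fibre s).toAbelianVariety
          ((Scheme.Modules.pullback (pullback.map A₀.X.hom s A₀.X.hom T.hom (𝟙 _) u (𝟙 _)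
            (by rw [Category.comp_id, Category.id_comp]) (by rw [Category.comp_id, hs]))).obj M) := by
    intro s u hs
    subst hs
    set A := AbelianSchemeOver.ofAbelianVariety A₀ with hA
    -- `e ≫ (A₀ × u) = pr : (A_T)_u → A_T` for `e : (A_T)_u ≅ A_{u ≫ (T → Spec k)}`
    have he : AbelianVariety.Hom.toSchemeHom (A.fibreBaseChangeIso T.hom u).hom ≫
        pullback.map A₀.X.hom (u ≫ T.hom) A₀.X.hom T.hom (𝟙 _) u (𝟙 _)
          (by rw [Category.comp_id, Category.id_comp]) (by rw [Category.comp_id]) =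
        pullback.fst (A.baseChange T.hom).X.hom u := by
      apply pullback.hom_ext
      · rw [Category.assoc, pullback.lift_fst, Category.comp_id]
        exact A.fibreBaseChangeIso_hom_toSchemeHom_fst T.hom u
      · rw [Category.assoc, pullback.lift_snd, ← Category.assoc]
        have h2 := A.fibreBaseChangeIso_hom_toSchemeHom_snd T.hom u
        calc (AbelianVariety.Hom.toSchemeHom (A.fibreBaseChangeIso T.hom u).hom ≫
              pullback.snd A₀.X.hom (u ≫ T.hom)) ≫ u
            = pullback.snd (A.baseChange T.hom).X.hom u ≫ u := by exact congrArg (· ≫ u) h2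
          _ = pullback.fst (A.baseChange T.hom).X.hom u ≫ pullback.snd A₀.X.hom T.hom :=
              (pullback.condition (f := (A.baseChange T.hom).X.hom) (g := u)).symm
    rw [← isHomogeneous_pullback_iff_of_iso (A.fibreBaseChangeIso T.hom u)]
    refine isHomogeneous_iff_of_iso _ ?_
    exact ((Scheme.Modules.pullbackCongr he).app M).symm ≪≫ ((Scheme.Modules.pullbackComp _ _).app M).symm
  exact key (AbelianVariety.bcSpec k L) t.left (Over.w t)

end Fibre

/-! ### §4 The trivial locus at an `L`-point of the base -/

section TrivialLocusPoint

variable (P : SchemeOver k) [IsProper P.hom] [GeometricallyIntegral P.hom] {W : SchemeOver k}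
  [IsIntegral (P ⊗ W).left] (L : Type u) [Field L] [Algebra k L]

omit [IsProper P.hom] [IsIntegral (P ⊗ W).left] in
/-- `P ⊗ Spec L` is integral for `P → Spec k` geometrically integral. [cite: GortzWedhorn2020, Prop. 5.51] -/
private theorem isIntegral_tensorObj_specOver_left : IsIntegral (P ⊗ specOver k L).left :=
  GeometricallyIntegral.geometrically_isIntegral (f := P.hom) (specOver k L).hom _ _
    (IsPullback.of_hasPullback P.hom (specOver k L).hom)

/-- **An `L`-point `w` of the base lies in the trivial locus `Z(D)` of a divisor `D` on `P × W` iff the class of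
`D` along `P × w : P ⊗ Spec L → P × W` is trivial** — the trivial locus is compatible with base change (★
`CartierDivisor.preimage_trivialLocus_eq`, [GortzWedhorn2023] Thm. 24.66 (1)), and on the one-point base `Spec L`
the fibre class at the point is the class itself up to the residue-field extension `κ(pt) = L`, along which
triviality descends (★ `linEquiv_zero_of_classPullback_whiskerLeft_fieldExt`). [cite: GortzWedhorn2023, Thm. 24.66 (1) (p. 405) and Lemma 24.65 (p. 405)] -/
theorem base_mem_trivialLocus_iff (D : CartierDivisor (P ⊗ W).left) (w : specOver k L ⟶ W) :
    w.left.base (IsLocalRing.closedPoint L) ∈ CartierDivisor.trivialLocus P W D ↔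
      (D.classPullback (P ◁ w).left).LinEquiv 0 := by
  haveI := isIntegral_tensorObj_specOver_left P L
  have hpre := CartierDivisor.preimage_trivialLocus_eq P w D
  have hmem : w.left.base (IsLocalRing.closedPoint L) ∈ CartierDivisor.trivialLocus P W D ↔
      IsLocalRing.closedPoint L ∈
        CartierDivisor.trivialLocus P (specOver k L) (D.classPullback (P ◁ w).left) := by
    rw [← hpre]; rfl
  rw [hmem]
  refine ⟨fun h => ?_, fun h => ?_⟩
  · rw [CartierDivisor.mem_trivialLocus_iff] at h
    exact CartierDivisor.linEquiv_zero_of_classPullback_whiskerLeft_fieldExt P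
      (residuePtι (specOver k L) (IsLocalRing.closedPoint L)) _ h
  · rw [CartierDivisor.trivialLocus_eq_univ_of_linEquiv_zero h]
    exact Set.mem_univ _

end TrivialLocusPoint

/-! ### §5 The `Pic⁰` locus over an INTEGRAL base is closed -/

section Closed

variable [IsIntegral T.left] [LocallyOfFiniteType T.hom]

/-- **The `Pic⁰` locus of a rank-one module `M` on `A₀ × T` is closed, `T` integral and locally of finite type
over the field `k`** ([MumfordAV1970] §8, §10; [MilneAV2008] I §8): the set of `x ∈ T` such that for EVERY
algebraically closed `Ω` and every geometric point `t : Spec Ω → T` over `x` the fibre `M_t` is homogeneous on the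
fibre abelian variety `(A₀ × T)_t` (★ `IsHomogeneous`) is closed.  Proof: it is the complement of the image under
the OPEN projection `pr_T : A₀ × T → T` (flat of finite presentation ⇒ universally open) of the complement of the
CLOSED trivial locus `Z ⊆ A₀ × T` (seesaw, ★ `seesaw_isClosed_trivialLocus_holds`) of the family
`N(M) = {t_b^*M_s ⊗ M_s⁻¹}_{(b, s)}` on `A₀ × (A₀ × T)`; «`x ∈` locus ⟺ `pr_T⁻¹(x) ⊆ Z`» by the slice formula §1,
§2, §3 and §4 at the geometric points over `x`. [cite: MumfordAV1970, §8 (pp. 74–80) and §10 (p. 89)]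
[cite: GortzWedhorn2023, Thm. 24.66 (1), (3) (pp. 405–408)] -/
theorem isClosed_setOf_forall_isHomogeneous_fibre (M : (A₀.X ⊗ T).left.Modules) (h₁ : HasRank M 1) :
    IsClosed {x : T.left | ∀ (Ω : Type u) [Field Ω] [IsAlgClosed Ω] (t : Spec (.of Ω) ⟶ T.left),
      t.base (IsLocalRing.closedPoint Ω) = x →
        IsHomogeneous (((AbelianSchemeOver.ofAbelianVariety A₀).baseChange T.hom).fibre t).toAbelianVariety
          ((Scheme.Modules.pullback
            (pullback.fst ((AbelianSchemeOver.ofAbelianVariety A₀).baseChange T.hom).X.hom t)).obj M)} := by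
  -- instances
  haveI : IsProper A₀.X.hom := A₀.isProper
  haveI : GeometricallyIntegral A₀.X.hom := A₀.geometricallyIntegral
  haveI : UniversallyOpen A₀.X.hom := (AbelianSchemeOver.ofAbelianVariety A₀).universallyOpen_hom
  haveI : Smooth A₀.X.hom := A₀.smooth_hom
  haveI : Flat A₀.X.hom := inferInstance
  haveI : IsLocallyNoetherian T.left := LocallyOfFiniteType.isLocallyNoetherian T.hom
  haveI : IsIntegral (A₀.X ⊗ T).left := inferInstanceAs (IsIntegral (pullback A₀.X.hom T.hom))
  haveI : LocallyOfFiniteType (A₀.X ⊗ T).hom := by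
    rw [Over.tensorObj_hom]; infer_instance
  haveI : IsLocallyNoetherian (A₀.X ⊗ T).left := LocallyOfFiniteType.isLocallyNoetherian (A₀.X ⊗ T).hom
  haveI : IsIntegral (A₀.X ⊗ (A₀.X ⊗ T)).left :=
    inferInstanceAs (IsIntegral (pullback A₀.X.hom (A₀.X ⊗ T).hom))
  -- the class `c = [M]`, the family class `N(M)` and a divisor `D` for it
  have hM : IsFiniteLocallyFree M := HasRank.isFiniteLocallyFree' h₁
  set mT : A₀.X ⊗ (A₀.X ⊗ T) ⟶ A₀.X ⊗ T :=
    lift (fst A₀.X (A₀.X ⊗ T) * (snd A₀.X (A₀.X ⊗ T) ≫ fst A₀.X T)) (snd A₀.X (A₀.X ⊗ T) ≫ snd A₀.X T)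
    with hmT
  set Nc : CechPic (A₀.X ⊗ (A₀.X ⊗ T)).left :=
    CechPic.pullback mT.left (detClass hM) * (CechPic.pullback (A₀.X ◁ snd A₀.X T).left (detClass hM))⁻¹
    with hNc
  obtain ⟨D, hD⟩ := CechPic.exists_cechClass_eq Nc
  -- its trivial locus `Z ⊆ A₀ × T` is closed (seesaw) and the projection `pr_T` is open
  set Z : Set (A₀.X ⊗ T).left := CartierDivisor.trivialLocus A₀.X (A₀.X ⊗ T) D with hZ
  have hZc : IsClosed Z := seesaw_isClosed_trivialLocus_holds k A₀.X (A₀.X ⊗ T) D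
  have hpr : IsOpenMap (snd A₀.X T).left.base := by
    rw [Over.snd_left]
    exact (pullback.snd A₀.X.hom T.hom).isOpenMap
  -- KEY: the class of `D` along the slice `A₀ × (a, t)` is `t_a^*[j_t^*M]·[j_t^*M]⁻¹`
  have hkey : ∀ (L : Type u) [Field L] [Algebra k L] (a : A₀.Points L) (t : AlgPoints T L),
      (D.classPullback (A₀.X ◁ lift a t).left).LinEquiv 0 ↔
        CechPic.pullback (A₀.transl L a) (detClass (hM.pullback (A₀.X ◁ t).left)) =
          detClass (hM.pullback (A₀.X ◁ t).left) := by
    intro L _ _ a t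
    haveI : IsIntegral (A₀.X ⊗ specOver k L).left :=
      GeometricallyIntegral.geometrically_isIntegral (f := A₀.X.hom) (specOver k L).hom _ _
        (IsPullback.of_hasPullback A₀.X.hom (specOver k L).hom)
    let j' : A₀.bcLeft L ⟶ (A₀.X ⊗ T).left := (A₀.X ◁ t).left
    let G' : A₀.bcLeft L ⟶ (A₀.X ⊗ (A₀.X ⊗ T)).left := (A₀.X ◁ lift a t).left
    have h1 : CechPic.pullback G' Nc =
        CechPic.pullback (A₀.transl L a) (CechPic.pullback j' (detClass hM)) *
          (CechPic.pullback j' (detClass hM))⁻¹ := by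
      rw [hNc, hmT]
      exact cechPic_pullback_whiskerLeft_lift_familyClass A₀ T L (detClass hM) a t j' rfl G' rfl
    rw [← CartierDivisor.cechClass_eq_iff_linEquiv, CartierDivisor.cechClass_zero,
      ← CartierDivisor.pullback_cechClass_eq_cechClass_classPullback, hD]
    show CechPic.pullback G' Nc = 1 ↔ _
    rw [h1, mul_inv_eq_one, detClass_pullback _ hM]
  -- the locus is the complement of `pr_T (A₀ × T ∖ Z)`
  have hS : {x : T.left | ∀ (Ω : Type u) [Field Ω] [IsAlgClosed Ω] (t : Spec (.of Ω) ⟶ T.left),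
      t.base (IsLocalRing.closedPoint Ω) = x →
        IsHomogeneous (((AbelianSchemeOver.ofAbelianVariety A₀).baseChange T.hom).fibre t).toAbelianVariety
          ((Scheme.Modules.pullback
            (pullback.fst ((AbelianSchemeOver.ofAbelianVariety A₀).baseChange T.hom).X.hom t)).obj M)} =
      ((snd A₀.X T).left.base '' Zᶜ)ᶜ := by
    ext x
    simp only [Set.mem_setOf_eq, Set.mem_compl_iff, Set.mem_image, not_exists, not_and]
    constructor
    · -- `⊆`: a point `z ∉ Z` over `x` contradicts homogeneity at the geometric point `κ(z)^alg` over `x`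
      intro hx z hz hzx
      apply hz
      -- the geometric point of `A₀ × T` through `z`
      set Ω := AlgebraicClosure ((A₀.X ⊗ T).left.residueField z) with hΩ
      set w₀ : Spec (.of Ω) ⟶ (A₀.X ⊗ T).left :=
        Spec.map (CommRingCat.ofHom (algebraMap ((A₀.X ⊗ T).left.residueField z) Ω)) ≫
          (A₀.X ⊗ T).left.fromSpecResidueField z with hw₀
      have hw₀z : w₀.base (IsLocalRing.closedPoint Ω) = z := by
        rw [hw₀, Scheme.Hom.comp_base, TopCat.coe_comp, Function.comp_apply]
        exact Scheme.fromSpecResidueField_apply _ _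
      obtain ⟨σ, hσ⟩ : ∃ σ : k →+* Ω, Spec.map (CommRingCat.ofHom σ) = w₀ ≫ (A₀.X ⊗ T).hom :=
        ⟨(Spec.preimage (w₀ ≫ (A₀.X ⊗ T).hom)).hom, Spec.map_preimage _⟩
      letI : Algebra k (AlongHom Ω σ) := AlongHom.instAlgebra σ
      haveI : IsAlgClosed (AlongHom Ω σ) := (inferInstance : IsAlgClosed Ω)
      let w : specOver k (AlongHom Ω σ) ⟶ A₀.X ⊗ T := Over.homMk w₀ hσ.symm
      have hw : lift (w ≫ fst A₀.X T) (w ≫ snd A₀.X T) = w :=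
        CartesianMonoidalCategory.hom_ext _ _ (lift_fst _ _) (lift_snd _ _)
      -- homogeneity at the geometric point `w ≫ pr_T` of `T` over `x`
      have ht : (w ≫ snd A₀.X T).left.base (IsLocalRing.closedPoint (AlongHom Ω σ)) = x := by
        rw [Over.comp_left, Scheme.Hom.comp_base, TopCat.coe_comp, Function.comp_apply]
        exact (congrArg ((snd A₀.X T).left.base) hw₀z).trans hzx
      have hhom := hx (AlongHom Ω σ) (w ≫ snd A₀.X T).left ht
      rw [isHomogeneous_fibre_iff_baseChange A₀ T (AlongHom Ω σ) (w ≫ snd A₀.X T) M,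
        isHomogeneous_baseChange_iff_forall_transl A₀ (AlongHom Ω σ) (hasRank_pullback _ h₁)
          (hM.pullback _)] at hhom
      have h1 := (hkey (AlongHom Ω σ) (w ≫ fst A₀.X T) (w ≫ snd A₀.X T)).2 (hhom (w ≫ fst A₀.X T))
      rw [hw] at h1
      rw [← hw₀z]
      exact (base_mem_trivialLocus_iff A₀.X (AlongHom Ω σ) D w).2 h1
    · -- `⊇`: if `pr_T⁻¹(x) ⊆ Z`, every geometric fibre over `x` is homogeneous
      intro hx Ω _ _ t htx
      obtain ⟨σ, hσ⟩ : ∃ σ : k →+* Ω, Spec.map (CommRingCat.ofHom σ) = t ≫ T.hom :=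
        ⟨(Spec.preimage (t ≫ T.hom)).hom, Spec.map_preimage _⟩
      letI : Algebra k (AlongHom Ω σ) := AlongHom.instAlgebra σ
      let t' : AlgPoints T (AlongHom Ω σ) := Over.homMk t hσ.symm
      refine (isHomogeneous_fibre_iff_baseChange A₀ T (AlongHom Ω σ) t' M).2
        ((isHomogeneous_baseChange_iff_forall_transl A₀ (AlongHom Ω σ) (hasRank_pullback _ h₁)
          (hM.pullback _)).2 fun a => ?_)
      refine (hkey (AlongHom Ω σ) a t').1 ?_
      refine (base_mem_trivialLocus_iff A₀.X (AlongHom Ω σ) D (lift a t')).1 ?_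
      -- the point `(a, t)` of `A₀ × T` lies over `x`, hence in `Z`
      by_contra hz
      refine hx _ hz ?_
      have e : (lift a t').left ≫ (snd A₀.X T).left = t := by
        rw [← Over.comp_left, lift_snd]
        exact rfl
      rw [← Scheme.Hom.comp_apply, e]
      exact htx
  rw [hS]
  exact (hpr _ hZc.isOpen_compl).isClosed_compl

end Closed

/-! ### §6 The locus condition along a `k`-morphism of bases -/

section Restrict

variable {T} {T'' : SchemeOver k} (g : T'' ⟶ T) (L : Type u) [Field L] [Algebra k L]

/-- **Homogeneity of the fibre at `t ≫ g` for `M` is homogeneity of the fibre at `t` for `(A₀ × g)^* M`** — both are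
homogeneity of `j^* M` on `(A₀)_L` for `j = A₀ × (t ≫ g) = (A₀ × t) ≫ (A₀ × g)` (§3 twice). [cite: GortzWedhorn2020, Section (4.7) (pp. 107–108)]
[cite: Mukai1978, Def. 4.4 (p. 253)] -/
theorem isHomogeneous_fibre_comp_iff (t : AlgPoints T'' L) (M : (A₀.X ⊗ T).left.Modules) :
    IsHomogeneous (((AbelianSchemeOver.ofAbelianVariety A₀).baseChange T.hom).fibre (t ≫ g).left).toAbelianVariety
        ((Scheme.Modules.pullback
          (pullback.fst ((AbelianSchemeOver.ofAbelianVariety A₀).baseChange T.hom).X.hom (t ≫ g).left)).obj M) ↔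
      IsHomogeneous (((AbelianSchemeOver.ofAbelianVariety A₀).baseChange T''.hom).fibre t.left).toAbelianVariety
        ((Scheme.Modules.pullback
          (pullback.fst ((AbelianSchemeOver.ofAbelianVariety A₀).baseChange T''.hom).X.hom t.left)).obj
          ((Scheme.Modules.pullback (A₀.X ◁ g).left).obj M)) := by
  rw [isHomogeneous_fibre_iff_baseChange A₀ T L (t ≫ g) M,
    isHomogeneous_fibre_iff_baseChange A₀ T'' L t ((Scheme.Modules.pullback (A₀.X ◁ g).left).obj M)]
  refine isHomogeneous_iff_of_iso _ ?_
  have e : (A₀.X ◁ (t ≫ g)).left = (A₀.X ◁ t).left ≫ (A₀.X ◁ g).left := by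
    rw [MonoidalCategory.whiskerLeft_comp, Over.comp_left]
  exact (Scheme.Modules.pullbackCongr e).app M ≪≫ ((Scheme.Modules.pullbackComp _ _).app M).symm

end Restrict

/-! ### §7 Geometric points factor through the REDUCED closed subscheme carrying their image -/

section Factor

/-- The kernel ideal sheaf of a quasi-compact morphism from a reduced scheme is the vanishing ideal sheaf of the closure
of its image (the statement of ★ `HodgeTheory/FermatSectionChartIdeal.ker_eq_vanishingIdeal_of_isReduced`, re-derived privately to
keep the import cone small). [cite: Hartshorne1977, II Ex. 3.11 (d)] -/
private theorem ker_eq_vanishingIdeal_of_isReduced' {X Y : Scheme.{u}} (f : X ⟶ Y) [QuasiCompact f] [IsReduced X] :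
    f.ker = Scheme.IdealSheafData.vanishingIdeal ⟨closure (Set.range f), isClosed_closure⟩ := by
  have hsupp : f.ker.support = ⟨closure (Set.range f), isClosed_closure⟩ :=
    TopologicalSpace.Closeds.ext (Scheme.Hom.support_ker f)
  have hrad : f.ker.radical = f.ker := by
    ext U : 2
    rw [Scheme.IdealSheafData.radical_ideal, Scheme.Hom.ker_apply]
    refine (Ideal.IsRadical.radical fun s ⟨n, hn⟩ ↦ ?_)
    rw [RingHom.mem_ker] at hn ⊢
    rw [map_pow] at hn
    exact IsReduced.eq_zero _ ⟨n, hn⟩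
  rw [← hsupp, Scheme.IdealSheafData.vanishingIdeal_support, hrad]

/-- **A morphism from the spectrum of a field whose image point lies in a closed subset `Z` factors through the
reduced closed subscheme `V(𝒥_Z)` of `Z`** (`𝒥_Z` the vanishing ideal sheaf; Mathlib `IsClosedImmersion.lift`: the
kernel of `Spec Ω → X` is the vanishing ideal of `{x}⁻ ⊆ Z`, which contains `𝒥_Z`). [cite: Hartshorne1977, II Ex. 3.11 (d)]
[cite: GortzWedhorn2020, Prop. 3.27] -/
theorem exists_fac_subschemeι_vanishingIdeal {X : Scheme.{u}} [IsAffine X] (Z : TopologicalSpace.Closeds X)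
    {Ω : Type u} [Field Ω] (t : Spec (.of Ω) ⟶ X) (ht : t.base (IsLocalRing.closedPoint Ω) ∈ Z) :
    ∃ t' : Spec (.of Ω) ⟶ (Scheme.IdealSheafData.vanishingIdeal Z).subscheme,
      t' ≫ (Scheme.IdealSheafData.vanishingIdeal Z).subschemeι = t := by
  haveI : QuasiCompact t := (HasAffineProperty.iff_of_isAffine (P := @QuasiCompact)).mpr inferInstance
  have hle : (Scheme.IdealSheafData.vanishingIdeal Z).subschemeι.ker ≤ t.ker := by
    rw [Scheme.IdealSheafData.ker_subschemeι, ker_eq_vanishingIdeal_of_isReduced' t]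
    refine Scheme.IdealSheafData.vanishingIdeal_antimono ?_
    change closure (Set.range t.base) ⊆ (Z : Set X)
    refine closure_minimal ?_ Z.isClosed
    rintro _ ⟨s, rfl⟩
    obtain rfl : s = IsLocalRing.closedPoint Ω := Subsingleton.elim _ _
    exact ht
  exact ⟨IsClosedImmersion.lift _ t hle, IsClosedImmersion.lift_fac _ t hle⟩

end Factor

/-! ### §8 The `Pic⁰` locus over an AFFINE base of finite type is closed (via the integral components) -/

section ClosedGeneral

variable [IsAffine T.left] [LocallyOfFiniteType T.hom]

/-- **The `Pic⁰` locus of a rank-one module `M` on `A₀ × T` is closed for `T` AFFINE of finite type over `k`**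
(reducible and non-reduced `T` allowed): `T` is Noetherian; for each of its finitely many irreducible components `Z`,
with REDUCED structure `ι_Z : T_Z = V(𝒥_Z) ↪ T` (★ `Morphisms/SubschemeIntegral.isIntegral_subscheme`: integral), the
locus of the restricted family `(A₀ × ι_Z)^* M` is closed in `T_Z` (§5), and the locus of `M` is the (finite) union of
their images — «⊆» by §6, «⊇» because a geometric point of `T` over a point of `Z` factors through the reduced `T_Z`
(§7) and `ι_Z` is injective. [cite: MumfordAV1970, §8 (pp. 74–80) and §10 (p. 89)] [cite: GortzWedhorn2023, Thm. 24.66 (1), (3) (pp. 405–408)] -/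
theorem isClosed_setOf_forall_isHomogeneous_fibre_of_isAffine (M : (A₀.X ⊗ T).left.Modules) (h₁ : HasRank M 1) :
    IsClosed {x : T.left | ∀ (Ω : Type u) [Field Ω] [IsAlgClosed Ω] (t : Spec (.of Ω) ⟶ T.left),
      t.base (IsLocalRing.closedPoint Ω) = x →
        IsHomogeneous (((AbelianSchemeOver.ofAbelianVariety A₀).baseChange T.hom).fibre t).toAbelianVariety
          ((Scheme.Modules.pullback
            (pullback.fst ((AbelianSchemeOver.ofAbelianVariety A₀).baseChange T.hom).X.hom t)).obj M)} := by
  haveI : IsLocallyNoetherian T.left := LocallyOfFiniteType.isLocallyNoetherian T.hom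
  haveI : IsNoetherian T.left := {}
  -- notation: the locus of a family over a `k`-scheme
  let S : ∀ (W : SchemeOver k) (N : (A₀.X ⊗ W).left.Modules), Set W.left := fun W N =>
    {x : W.left | ∀ (Ω : Type u) [Field Ω] [IsAlgClosed Ω] (t : Spec (.of Ω) ⟶ W.left),
      t.base (IsLocalRing.closedPoint Ω) = x →
        IsHomogeneous (((AbelianSchemeOver.ofAbelianVariety A₀).baseChange W.hom).fibre t).toAbelianVariety
          ((Scheme.Modules.pullback
            (pullback.fst ((AbelianSchemeOver.ofAbelianVariety A₀).baseChange W.hom).X.hom t)).obj N)}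
  -- the reduced structure on a closed irreducible subset, as a `k`-scheme over `T`
  let J : ∀ Z : TopologicalSpace.Closeds T.left, T.left.IdealSheafData := fun Z =>
    Scheme.IdealSheafData.vanishingIdeal Z
  let TZ : ∀ Z : TopologicalSpace.Closeds T.left, SchemeOver k := fun Z => Over.mk ((J Z).subschemeι ≫ T.hom)
  let ιZ : ∀ Z : TopologicalSpace.Closeds T.left, TZ Z ⟶ T := fun Z => Over.homMk (J Z).subschemeι rfl
  -- an `Ω`-point of a `k`-scheme `W` as an `AlongHom Ω σ`-point over `k`
  have hconv : ∀ (W : SchemeOver k) (N : (A₀.X ⊗ W).left.Modules) (x : W.left),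
      x ∈ S W N ↔ ∀ (L : Type u) [Field L] [Algebra k L] [IsAlgClosed L] (t : AlgPoints W L),
        t.left.base (IsLocalRing.closedPoint L) = x →
          IsHomogeneous (((AbelianSchemeOver.ofAbelianVariety A₀).baseChange W.hom).fibre t.left).toAbelianVariety
            ((Scheme.Modules.pullback
              (pullback.fst ((AbelianSchemeOver.ofAbelianVariety A₀).baseChange W.hom).X.hom t.left)).obj N) := by
    intro W N x
    refine ⟨fun h L _ _ _ t ht => h L t.left ht, fun h Ω _ _ t ht => ?_⟩
    obtain ⟨σ, hσ⟩ : ∃ σ : k →+* Ω, Spec.map (CommRingCat.ofHom σ) = t ≫ W.hom :=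
      ⟨(Spec.preimage (t ≫ W.hom)).hom, Spec.map_preimage _⟩
    letI : Algebra k (AlongHom Ω σ) := AlongHom.instAlgebra σ
    haveI : IsAlgClosed (AlongHom Ω σ) := (inferInstance : IsAlgClosed Ω)
    exact h (AlongHom Ω σ) (Over.homMk t hσ.symm : AlgPoints W (AlongHom Ω σ)) ht
  -- the locus along the components
  have hZS : ∀ (Z : TopologicalSpace.Closeds T.left) (x' : (TZ Z).left),
      x' ∈ S (TZ Z) ((Scheme.Modules.pullback (A₀.X ◁ ιZ Z).left).obj M) ↔ (ιZ Z).left.base x' ∈ S T M := by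
    intro Z x'
    rw [hconv, hconv]
    constructor
    · intro h L _ _ _ t ht
      -- factor `t` through the reduced `T_Z`
      have htZ : t.left.base (IsLocalRing.closedPoint L) ∈ Z := by
        rw [ht]
        change (J Z).subschemeι.base x' ∈ (Z : Set T.left)
        have hx' : (J Z).subschemeι.base x' ∈ Set.range (J Z).subschemeι.base := ⟨x', rfl⟩
        rw [Scheme.IdealSheafData.range_subschemeι] at hx'
        change (J Z).subschemeι.base x' ∈ ((Scheme.IdealSheafData.vanishingIdeal Z).support : Set T.left) at hx'
        rwa [Scheme.IdealSheafData.coe_support_vanishingIdeal] at hx'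
      obtain ⟨t', ht'⟩ := exists_fac_subschemeι_vanishingIdeal Z t.left htZ
      let t'' : AlgPoints (TZ Z) L := Over.homMk t' (by
        change t' ≫ (J Z).subschemeι ≫ T.hom = _
        rw [← Category.assoc, ht']; exact Over.w t)
      have htt : t'' ≫ ιZ Z = t := by ext1; exact ht'
      rw [← htt, isHomogeneous_fibre_comp_iff A₀ (ιZ Z) L t'' M]
      refine h L t'' ?_
      apply (J Z).subschemeι.isClosedEmbedding.injective
      change ((t' ≫ (J Z).subschemeι).base) (IsLocalRing.closedPoint L) = _
      rw [ht']
      exact ht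
    · intro h L _ _ _ t' ht'
      rw [← isHomogeneous_fibre_comp_iff A₀ (ιZ Z) L t' M]
      refine h L (t' ≫ ιZ Z) ?_
      change ((ιZ Z).left.base) (t'.left.base (IsLocalRing.closedPoint L)) = _
      rw [ht']
  -- the closed sets `Z⁻` (for an irreducible component `Z`, `Z⁻ = Z`; the closure keeps the union non-dependent)
  let Zc : Set T.left → TopologicalSpace.Closeds T.left := fun Z => ⟨closure Z, isClosed_closure⟩
  -- the locus is the union over the irreducible components of the images of the component loci
  have hS : S T M = ⋃ Z ∈ irreducibleComponents T.left,
      (ιZ (Zc Z)).left.base '' S (TZ (Zc Z)) ((Scheme.Modules.pullback (A₀.X ◁ ιZ (Zc Z)).left).obj M) := by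
    ext x
    simp only [Set.mem_iUnion, Set.mem_image]
    constructor
    · intro hx
      refine ⟨irreducibleComponent x, irreducibleComponent_mem_irreducibleComponents x, ?_⟩
      have hxZ : x ∈ Set.range (J (Zc (irreducibleComponent x))).subschemeι.base := by
        rw [Scheme.IdealSheafData.range_subschemeι]
        change x ∈ ((Scheme.IdealSheafData.vanishingIdeal (Zc (irreducibleComponent x))).support : Set T.left)
        rw [Scheme.IdealSheafData.coe_support_vanishingIdeal]
        exact subset_closure mem_irreducibleComponent
      obtain ⟨x', hx'⟩ := hxZ
      exact ⟨x', (hZS _ x').2 (hx'.symm ▸ hx), hx'⟩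
    · rintro ⟨Z, -, x', hx', rfl⟩
      exact (hZS _ x').1 hx'
  -- each component locus is closed (§5 on the integral `T_Z`) and `ι_Z` is a closed embedding
  have hcl : ∀ Z ∈ irreducibleComponents T.left,
      IsClosed ((ιZ (Zc Z)).left.base '' S (TZ (Zc Z)) ((Scheme.Modules.pullback (A₀.X ◁ ιZ (Zc Z)).left).obj M)) := by
    intro Z hZ
    have hs : (((J (Zc Z)).support : TopologicalSpace.Closeds T.left) : Set T.left) = closure Z := by
      change ((Scheme.IdealSheafData.vanishingIdeal (Zc Z)).support : Set T.left) = closure Z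
      rw [Scheme.IdealSheafData.coe_support_vanishingIdeal]
      rfl
    have hrad : (J (Zc Z)).radical = J (Zc Z) := by
      have h := Scheme.IdealSheafData.vanishingIdeal_support (I := J (Zc Z))
      have hs' : (J (Zc Z)).support = Zc Z := TopologicalSpace.Closeds.ext hs
      rw [hs'] at h
      exact h.symm
    have hirr : IsIrreducible (((J (Zc Z)).support : TopologicalSpace.Closeds T.left) : Set T.left) := by
      rw [hs]
      exact hZ.1.closure
    haveI : IsIntegral (TZ (Zc Z)).left :=
      Literature.AlgebraicGeometry.Morphisms.isIntegral_subscheme (J (Zc Z)) hrad hirr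
    haveI : LocallyOfFiniteType (TZ (Zc Z)).hom := by
      change LocallyOfFiniteType ((J (Zc Z)).subschemeι ≫ T.hom)
      infer_instance
    exact (J (Zc Z)).subschemeι.isClosedEmbedding.isClosedMap _
      (isClosed_setOf_forall_isHomogeneous_fibre A₀ (TZ (Zc Z)) _ (hasRank_pullback _ h₁))
  change IsClosed (S T M)
  rw [hS]
  exact TopologicalSpace.NoetherianSpace.finite_irreducibleComponents.isClosed_biUnion hcl

end ClosedGeneral

/-- **The `Pic⁰` locus of a rigidified line bundle `ℒ` on `A₀ × T` is closed, `T` INTEGRAL and locally of finite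
type** (★ `AbelianSchemeOver.RigidifiedLineBundle` of `ofAbelianVariety A₀` over `f : T → Spec k`): the set of
`x ∈ T` over which every geometric fibre `ℒ_t` (★ `RigidifiedLineBundle.fibreModule`) is homogeneous is closed. [cite: MumfordAV1970, §8 (pp. 74–80) and §10 (p. 89)]
[cite: MilneAV2008, I §8 pp. 36–37] -/
theorem isClosed_picZeroLocus_of_isIntegral {T : Scheme.{u}} (f : T ⟶ Spec (.of k)) [IsIntegral T]
    [LocallyOfFiniteType f] (ℒ : (AbelianSchemeOver.ofAbelianVariety A₀).RigidifiedLineBundle f) :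
    IsClosed {x : T | ∀ (Ω : Type u) [Field Ω] [IsAlgClosed Ω] (t : Spec (.of Ω) ⟶ T),
      t.base (IsLocalRing.closedPoint Ω) = x →
        IsHomogeneous (((AbelianSchemeOver.ofAbelianVariety A₀).baseChange f).fibre t).toAbelianVariety
          (ℒ.fibreModule t)} := by
  haveI : IsIntegral (Over.mk f : SchemeOver k).left := ‹IsIntegral T›
  haveI : LocallyOfFiniteType (Over.mk f : SchemeOver k).hom := ‹LocallyOfFiniteType f›
  exact isClosed_setOf_forall_isHomogeneous_fibre A₀ (Over.mk f) ℒ.L ℒ.hasRank_one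

/-- **The `Pic⁰` locus of a rigidified line bundle `ℒ` on `A₀ × T` is closed, `T` AFFINE of finite type over any
field `k`** (reducible and non-reduced `T` allowed): the set of `x ∈ T` over which every geometric fibre `ℒ_t` is
homogeneous is closed ([MilneAV2008] I §8 condition (a) of the dual pair is a closed condition on the base).
[cite: MumfordAV1970, §8 (pp. 74–80) and §10 (p. 89)] [cite: MilneAV2008, I §8 pp. 36–37] -/
theorem isClosed_picZeroLocus {T : Scheme.{u}} (f : T ⟶ Spec (.of k)) [IsAffine T] [LocallyOfFiniteType f]
    (ℒ : (AbelianSchemeOver.ofAbelianVariety A₀).RigidifiedLineBundle f) :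
    IsClosed {x : T | ∀ (Ω : Type u) [Field Ω] [IsAlgClosed Ω] (t : Spec (.of Ω) ⟶ T),
      t.base (IsLocalRing.closedPoint Ω) = x →
        IsHomogeneous (((AbelianSchemeOver.ofAbelianVariety A₀).baseChange f).fibre t).toAbelianVariety
          (ℒ.fibreModule t)} := by
  haveI : IsAffine (Over.mk f : SchemeOver k).left := ‹IsAffine T›
  haveI : LocallyOfFiniteType (Over.mk f : SchemeOver k).hom := ‹LocallyOfFiniteType f›
  exact isClosed_setOf_forall_isHomogeneous_fibre_of_isAffine A₀ (Over.mk f) ℒ.L ℒ.hasRank_one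

end Literature.AlgebraicGeometry.AbelianVarieties

end
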